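import Mathlib.Algebra.Group.Subgroup.Map
import Mathlib.Data.Finset.Card
import HarnessLib

/-!
# Kolyvagin's REDEFINITION of `m_∞` as a KERNEL THEOREM over abstract Selmer data: the PRIME SWAP
# (McCallum 1991 Prop. 5.2, case `C = {0}`, stable range — in the level-`p` form of
# Burungale–Castella–Grossi–Skinner, Prop. 2.2.1) — cell `bsd-stepL`, seat `bsd-stepL-corner-p1` g8,
# helper toward item 19947 `NonSurjCornerKolyJ` (registered stub `stub_kolyJ_max`) and the 19111 kit's
# `stub_upper3_jetchevMax`; shared verbatim by 19109's `stub_jetchevMaxHLAtThree`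

HONEST FRAMING. Nothing here proves BSD, Jetchev's Thm. 1.4 at `p ∥ N`, or divides any Heegner point;
no registered stub is discharged; no item closes; 0 classes move (T7);
`--supports stmt-BirchSwinnertonDyer-19947` (helper). One theorem, no definition, no named fact.

WHAT. The reading-grade displays of the two max-form corner stubs (`…NonSurjCornerKolyJMaxOfPerLevel`,
p502196) and of 19109's stub (`…EulerHalvesAtThreeJetchevMaxOfPerLevel`) take TWO inputs: `hlev` (the
per-level inequality = tam3-p1's instantiated §6 walk) and `hK` = KOLYVAGIN'S REDEFINITION of `m_∞`:
«the minimum `m_∞` of `m(n)` over ALL admissible conductors is attained at conductors `n` all of whose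
prime factors are as deep (Kolyvagin index `M(ℓ)` as large) as one pleases» — McCallum, LMS LN 153
(1991), Prop. 5.2 with `C = {0}` (p. 304), which Jetchev's proof of Thm. 1.4 consumes as
«`m_∞ = lim_r inf_{c ∈ Λ^r_{m'}} m(c)` for every sufficiently large `m'`» (Compos. Math. 144 (2008),
Proof of Thm. 1.1, p. 824, citing [Kol91b, Thm. 1]). At `p = 3` under `ρ̄` onto it is the typed fact
`McCallum1991.prop52_exists_conductor_kolyvaginClass_order_eq` (binder: the `p`-adic TOWER is onto); on
the (T4′) corner (`ρ̄_{E,p}` irreducible, NOT onto) that fact is VOID and no source proves Prop. 5.2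
under irreducibility in body (Cha 2005 Rem. 25 ∕ Matar–Nekovář 2019 §0.11 assert the carry-over).
THIS FILE proves the combinatorial heart of Prop. 5.2 — the PRIME SWAP — as a theorem over abstract
data of exactly the kind the kernel §6 walk already uses (`…EulerHalvesAtThreeCoreVertex.lean`,
`exists_halfCoreVertex`: one ambient group with sign subgroups, localisations at Kolyvagin primes,
finite ∕ transverse local conditions, Selmer and relaxed-Selmer subgroups per conductor, alternating
signs, a Čebotarev supply for pairs of eigenclasses of opposite signs) PLUS a level-`p` local pairing
package (finite × transverse perfect on each sign; reciprocity for a relaxed class against a Selmer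
class over two Kolyvagin primes) and Prop. 4.4 in NON-VANISHING form. It is image-free, carrier-blind
and `p`-free (no prime, order or divisibility occurs: only «`≠ 0`»).

## The argument (BCGS Prop. 2.2.1, proof, pp. 14–16 of arXiv:2312.09301v3; McCallum pp. 305–306)
Level `p`: let `M := m_∞` and work with the conductors `n` over Kolyvagin primes of index `≥ M + 1`;
by minimality `P_n ∈ p^M E(K[n])` for all of them, so the level-`p^{M+1}` class `c_{M+1}(n)` is
`p`-torsion and — `E(K)[p] = 0` — IS a level-`p` class `κ̄_n ∈ H¹_{𝓕(n)}(K, E[p])^{ε_n}`, non-zero iff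
`p^M ∥ P_n` (McCallum Cor. 4.5). SWAP STEP: `n` with `κ̄_n ≠ 0` and a shallow prime `ℓ₀ ∣ n`. Take
`0 ≠ c ∈ H¹_{𝓕(n/ℓ₀)^{ℓ₀}}(K, E[p])^{−ε_n}` (relaxed at `ℓ₀`; exists by global duality — McCallum
Lemma 5.3 ∕ the walk's `hPT` at level `p`); a deep Kolyvagin prime `ℓ ∤ n` with `loc_ℓ κ̄_n ≠ 0`,
`loc_ℓ c ≠ 0` (Čebotarev for two eigenclasses of opposite signs: McCallum Cor. 3.2 ∕ [J] Lemma 6.1 —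
on the corner `…NonSurjCornerKolyJWalkCebotarev`, p501512); then `loc_ℓ κ̄_{nℓ} ≠ 0` (Prop. 4.4),
`κ̄_{nℓ} ∈ H¹_{𝓕(nℓ)}^{−ε_n}` is transverse at `ℓ` and `c` is finite at `ℓ`, so
`⟨loc_ℓ κ̄_{nℓ}, loc_ℓ c⟩_ℓ ≠ 0` (finite × transverse is a perfect pairing of LINES on each sign at
level `p` — this is why the argument must be run at level `p`, see the NOTE); reciprocity
`⟨·,·⟩_{ℓ₀} + ⟨·,·⟩_ℓ = 0` (all other local terms vanish: same self-orthogonal condition) forces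
`loc_{ℓ₀} κ̄_{nℓ} ≠ 0`, whence (Prop. 4.4 at `ℓ₀ ∣ nℓ`) `κ̄_{nℓ/ℓ₀} ≠ 0`: the shallow `ℓ₀` has been
traded for the deep `ℓ`. Induction on the number of shallow primes.
NOTE (for the referee; does not affect the typed FACT `prop52_…`, which is Kolyvagin's theorem): the
printed proof of McCallum's Prop. 5.2 takes the auxiliary class «`c ∈ H¹(K, E_p)^{−ε_r}`» and pairs it
with `c_{M_r+1}(nl')` by «Proposition 2.2» (stated for two classes in `H¹(K, E_p)`); at `λ'` the class
`c_{M_r+1}(nl')_{λ'}` is transverse of order `p` (Prop. 4.4) and in `H¹(K_{λ'}, E[p^M])^{±}`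
(`M = M_r + 1 ≥ 2`) two elements of order `p` in (transverse, finite) position pair to
`p^{2M−2}·unit = 0`; the non-vanishing McCallum asserts is that of the TATE pairing
`H¹(K_{λ'}, E)[p^M] × E(K_{λ'})/p^M` against a local point `y ∉ pE(K_{λ'})` (a generator of the cyclic
eigen-line), which is not the localisation of a level-`p^M` global class. BCGS's device — in the
stable range `c_{M_r+1}(nl')` is `p`-torsion, hence a level-`p` class, and everything is paired at
level `p` — is what makes the reciprocity step honest; it is the form proved here. (McCallum's general
`r`, outside the stable range, is not needed by any consumer in the tree.)

## Dictionary for `exists_deep_conductor_of_swap` (the caller instantiates; cf. `exists_halfCoreVertex`)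
`P ↦` the Kolyvagin primes `ℓ` of index `M(ℓ) ≥ M + 1` (`M = m_∞`), `Deep ℓ ↦ M(ℓ) ≥ e`; conductors
`n : Finset P` (square-free products); `G ↦ H¹(K, E[p])`, `Gs s ↦` its `τ`-eigen-subgroups;
`loc ℓ ↦ loc_λ`, `Hf ℓ s ∕ Htr ℓ s ↦ H¹_f(K_λ, E[p])^s ∕ H¹_tr(K_λ, E[p])^s`; `Sel n s ↦ H¹_{𝓕(n)}^s`,
`Rel n ℓ₀ s ↦ H¹_{𝓕(n)^{ℓ₀}}^s` (relaxed at `ℓ₀ ∉ n`), with `hSelT` (classes of `𝓕(nℓ)` are transverse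
at `ℓ`), `hRelf` (classes of `𝓕(n)^{ℓ₀}` are finite at every `ℓ ∉ n`, `ℓ ≠ ℓ₀`), `hSelGs ∕ hRelGs`
(sign bookkeeping), `haux` (a non-zero relaxed class of each sign: global duality, McCallum Lemma 5.3
at level `p` — e.g. from the walk's `hPT`: `#loc_{ℓ₀}(H¹_{𝓕(n)^{ℓ₀}}^s) = p > 1`); `h61 ↦` Čebotarev for
a pair (sign `s`, sign `−s`), both non-zero, producing a DEEP prime outside any given conductor with
both localisations non-zero (McCallum Cor. 3.2 ∕ [J] Lemma 6.1 at level `p` with primes of index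
`≥ e`); `pair ℓ ↦` the local Tate pairing on `H¹(K_λ, E[p])` (cup product and Weil pairing),
`hperf ↦` transverse^s × finite^s → `ℤ/p` is perfect between lines, `hrec ↦` Poitou–Tate reciprocity
`Σ_v inv_v(a_v ∪ b_v) = 0` for `a ∈ H¹_{𝓕(n)^{ℓ₀}}^s`, `b ∈ H¹_{𝓕(nℓ₀ℓ)}^s`, all terms outside `{ℓ₀, ℓ}`
vanishing (McCallum Prop. 2.2 + isotropy of the finite and transverse conditions, Lemma 5.3);
`e n ↦ ε_n = (−1)^{#n} ε`, `he`; `κ n ↦ κ̄_n` (the level-`p` class of `c_{M+1}(n)`), `hκ ↦`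
`κ̄_n ∈ H¹_{𝓕(n)}^{ε_n}` (Gross Prop. 5.4 signs; McCallum Lemma 4.3 ∕ [J] Prop. 4.9 local conditions),
`h44 ↦` McCallum Prop. 4.4 («`ord c_M(mℓ)_λ = ord c_M(m)_λ`») in the form `loc_ℓ κ̄_{nℓ} = 0 ↔
loc_ℓ κ̄_n = 0`. CONCLUSION: every `n` with `κ̄_n ≠ 0` has a conductor `n'` with ALL primes deep,
`#n' = #n`, `κ̄_{n'} ≠ 0` — i.e. `p^M ∥ P_{n'}`, `M(n') ≥ e`: `m_∞` is attained at depth `≥ e`.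
The tree-currency corollary (the `hK` clause of the displays) is `…NonSurjCornerKolyJRedefinition.lean`.
References (locators only; no cited FACT declared): [cite: McCallumLMS1991, §2 Prop. 2.1–2.2 (p. 297),
§3 Cor. 3.2 (p. 299), §4 Lemma 4.3, Prop. 4.4, Cor. 4.5 (pp. 300–302), §5 Lemma 5.1, Prop. 5.2,
Lemma 5.3 and proof of Prop. 5.2 (pp. 303–306)] [cite: BurungaleEtAl2026, Prop. 2.2.1 and its
proof (§2.2; arXiv:2312.09301)] [cite: Jetchev2008, Lemma 5.1 (p. 821), Proof of Thm. 1.1 (p. 824)]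
[cite: GrossLMS1991, Prop. 5.4]. Design: `Type*`-polymorphic, Bool signs, `Finset P` conductors, as in
`exists_halfCoreVertex`. Axioms: `propext`, `Classical.choice`, `Quot.sound`.
-/

set_option autoImplicit false

namespace Summit.BirchSwinnertonDyer.Rank1Residual.JET.Section6

variable {G : Type*} [AddCommGroup G] {P : Type*} [DecidableEq P]
  {L : P → Type*} [∀ ℓ, AddCommGroup (L ℓ)] {Z : Type*} [AddCommGroup Z]

/-- **Kolyvagin's redefinition of `m_∞` — the prime swap (McCallum 1991 Prop. 5.2, `C = {0}`, stable
range; BCGS Prop. 2.2.1), abstract.** Data and dictionary: module docstring. If the level-`p` class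
`κ̄_n` of a conductor `n` is non-zero, then some conductor `n'` consisting of DEEP primes only, with as
many prime factors as `n`, has `κ̄_{n'} ≠ 0`. Proof: induction on the number of shallow primes of `n`;
the swap step trades a shallow `ℓ₀ ∣ n` for a deep Čebotarev prime `ℓ` through an auxiliary relaxed
class `c`, the perfect finite × transverse pairing at `ℓ`, reciprocity over `{ℓ₀, ℓ}`, and Prop. 4.4
at `ℓ` and at `ℓ₀`. [cite: McCallumLMS1991, §5 Prop. 5.2 and its proof (pp. 304–306), Lemma 5.3,
§4 Prop. 4.4, §3 Cor. 3.2, §2 Prop. 2.2] [cite: BurungaleEtAl2026, Prop. 2.2.1 (§2.2)] -/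
theorem exists_deep_conductor_of_swap
    (loc : ∀ ℓ : P, G →+ L ℓ) (Hf Htr : ∀ ℓ : P, Bool → AddSubgroup (L ℓ))
    (Gs : Bool → AddSubgroup G) (Sel : Finset P → Bool → AddSubgroup G)
    (Rel : Finset P → P → Bool → AddSubgroup G)
    (hSelGs : ∀ n s, Sel n s ≤ Gs s) (hRelGs : ∀ n ℓ₀ s, ℓ₀ ∉ n → Rel n ℓ₀ s ≤ Gs s)
    (hSelT : ∀ n ℓ s, ℓ ∉ n → Sel (insert ℓ n) s ≤ (Htr ℓ s).comap (loc ℓ))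
    (hRelf : ∀ n ℓ₀ ℓ s, ℓ₀ ∉ n → ℓ ∉ n → ℓ ≠ ℓ₀ → Rel n ℓ₀ s ≤ (Hf ℓ s).comap (loc ℓ))
    (haux : ∀ n ℓ₀ s, ℓ₀ ∉ n → ∃ c ∈ Rel n ℓ₀ s, c ≠ 0)
    (Deep : P → Prop)
    (h61 : ∀ (s : Bool) (x y : G), x ∈ Gs s → y ∈ Gs (!s) → x ≠ 0 → y ≠ 0 → ∀ n : Finset P,
      ∃ ℓ, Deep ℓ ∧ ℓ ∉ n ∧ loc ℓ x ≠ 0 ∧ loc ℓ y ≠ 0)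
    (pair : ∀ ℓ : P, L ℓ →+ L ℓ →+ Z)
    (hperf : ∀ ℓ s (x y : L ℓ), x ∈ Htr ℓ s → y ∈ Hf ℓ s → x ≠ 0 → y ≠ 0 → pair ℓ x y ≠ 0)
    (hrec : ∀ n ℓ₀ ℓ s (a b : G), ℓ₀ ∉ n → ℓ ∉ n → ℓ ≠ ℓ₀ → a ∈ Rel n ℓ₀ s →
      b ∈ Sel (insert ℓ (insert ℓ₀ n)) s →
      pair ℓ₀ (loc ℓ₀ b) (loc ℓ₀ a) + pair ℓ (loc ℓ b) (loc ℓ a) = 0)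
    (e : Finset P → Bool) (he : ∀ n ℓ, ℓ ∉ n → e (insert ℓ n) = !e n)
    (κ : Finset P → G) (hκ : ∀ n, κ n ∈ Sel n (e n))
    (h44 : ∀ n ℓ, ℓ ∉ n → (loc ℓ (κ (insert ℓ n)) = 0 ↔ loc ℓ (κ n) = 0))
    (n : Finset P) (hn : κ n ≠ 0) :
    ∃ n' : Finset P, (∀ ℓ ∈ n', Deep ℓ) ∧ n'.card = n.card ∧ κ n' ≠ 0 := by
  classical
  -- induction on the number `N` of shallow (non-deep) primes of `n`
  suffices h : ∀ (N : ℕ) (n : Finset P), (n.filter fun ℓ => ¬ Deep ℓ).card = N → κ n ≠ 0 →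
      ∃ n' : Finset P, (∀ ℓ ∈ n', Deep ℓ) ∧ n'.card = n.card ∧ κ n' ≠ 0 from h _ n rfl hn
  intro N
  induction N with
  | zero =>
    intro n hN hn
    refine ⟨n, fun ℓ hℓ => ?_, rfl, hn⟩
    by_contra hd
    have hmem : ℓ ∈ n.filter fun ℓ => ¬ Deep ℓ := Finset.mem_filter.mpr ⟨hℓ, hd⟩
    rw [Finset.card_eq_zero] at hN
    rw [hN] at hmem
    exact Finset.notMem_empty ℓ hmem
  | succ N ih =>
    intro n hN hn
    -- a shallow prime `ℓ₀ ∈ n`; write `n = insert ℓ₀ m` with `ℓ₀ ∉ m`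
    obtain ⟨ℓ₀, hℓ₀⟩ : (n.filter fun ℓ => ¬ Deep ℓ).Nonempty := by
      rw [← Finset.card_pos, hN]; exact Nat.succ_pos N
    obtain ⟨hℓ₀n, hℓ₀d⟩ := Finset.mem_filter.mp hℓ₀
    obtain ⟨m, hℓ₀m, rfl⟩ : ∃ m : Finset P, ℓ₀ ∉ m ∧ n = insert ℓ₀ m :=
      ⟨n.erase ℓ₀, Finset.notMem_erase ℓ₀ n, (Finset.insert_erase hℓ₀n).symm⟩
    -- the sign `s` of `κ̄_n`; an auxiliary non-zero class `c`, relaxed at `ℓ₀`, of sign `−s`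
    set s : Bool := e (insert ℓ₀ m) with hs
    obtain ⟨c, hcRel, hc0⟩ := haux m ℓ₀ (!s) hℓ₀m
    -- a deep Čebotarev prime `ℓ ∉ n` seeing both `κ̄_n` and `c`
    obtain ⟨ℓ, hℓD, hℓn, hℓκ, hℓc⟩ :=
      h61 s (κ (insert ℓ₀ m)) c (hSelGs _ _ (hκ _)) (hRelGs _ _ _ hℓ₀m hcRel) hn hc0 (insert ℓ₀ m)
    have hℓm : ℓ ∉ m := fun h => hℓn (Finset.mem_insert_of_mem h)
    have hℓℓ₀ : ℓ ≠ ℓ₀ := by rintro rfl; exact hℓn (Finset.mem_insert_self _ _)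
    -- the class at `nℓ`: non-zero and transverse at `ℓ` (Prop. 4.4), sign `−s`
    have he₁ : e (insert ℓ (insert ℓ₀ m)) = !s := he _ ℓ hℓn
    have hκ₁Sel : κ (insert ℓ (insert ℓ₀ m)) ∈ Sel (insert ℓ (insert ℓ₀ m)) (!s) := he₁ ▸ hκ _
    have hκ₁ℓ : loc ℓ (κ (insert ℓ (insert ℓ₀ m))) ≠ 0 := fun h => hℓκ ((h44 _ ℓ hℓn).mp h)
    have hκ₁tr : loc ℓ (κ (insert ℓ (insert ℓ₀ m))) ∈ Htr ℓ (!s) := hSelT _ ℓ (!s) hℓn hκ₁Sel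
    -- `c` is finite at `ℓ`; the local term at `ℓ` is non-zero
    have hcf : loc ℓ c ∈ Hf ℓ (!s) := hRelf m ℓ₀ ℓ (!s) hℓ₀m hℓm hℓℓ₀ hcRel
    have hpairℓ : pair ℓ (loc ℓ (κ (insert ℓ (insert ℓ₀ m)))) (loc ℓ c) ≠ 0 :=
      hperf ℓ (!s) _ _ hκ₁tr hcf hκ₁ℓ hℓc
    -- reciprocity over `{ℓ₀, ℓ}` forces the local term at `ℓ₀` to be non-zero
    have hsum := hrec m ℓ₀ ℓ (!s) c (κ (insert ℓ (insert ℓ₀ m))) hℓ₀m hℓm hℓℓ₀ hcRel hκ₁Sel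
    have hκ₁ℓ₀ : loc ℓ₀ (κ (insert ℓ (insert ℓ₀ m))) ≠ 0 := by
      intro h
      rw [h, map_zero, AddMonoidHom.zero_apply, zero_add] at hsum
      exact hpairℓ hsum
    -- the swapped conductor `n' = mℓ`: `nℓ = n'ℓ₀`, so `κ̄_{n'} ≠ 0` by Prop. 4.4 at `ℓ₀`
    have hℓ₀n' : ℓ₀ ∉ insert ℓ m := by
      rw [Finset.mem_insert, not_or]; exact ⟨hℓℓ₀.symm, hℓ₀m⟩
    have hcomm : insert ℓ (insert ℓ₀ m) = insert ℓ₀ (insert ℓ m) := Finset.insert_comm ℓ ℓ₀ m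
    have hκn' : κ (insert ℓ m) ≠ 0 := by
      intro h
      apply hκ₁ℓ₀
      rw [hcomm]
      exact (h44 _ ℓ₀ hℓ₀n').mpr (by rw [h, map_zero])
    -- counting: same number of primes, one shallow prime fewer
    have hcard : (insert ℓ m).card = (insert ℓ₀ m).card := by
      rw [Finset.card_insert_of_notMem hℓm, Finset.card_insert_of_notMem hℓ₀m]
    have hfilt : ((insert ℓ m).filter fun ℓ => ¬ Deep ℓ).card = N := by
      have h1 : (insert ℓ m).filter (fun ℓ => ¬ Deep ℓ) = m.filter (fun ℓ => ¬ Deep ℓ) := by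
        rw [Finset.filter_insert, if_neg (not_not_intro hℓD)]
      have h2 : (insert ℓ₀ m).filter (fun ℓ => ¬ Deep ℓ) =
          insert ℓ₀ (m.filter fun ℓ => ¬ Deep ℓ) := by
        rw [Finset.filter_insert, if_pos hℓ₀d]
      have h3 : ℓ₀ ∉ m.filter fun ℓ => ¬ Deep ℓ := fun h => hℓ₀m (Finset.mem_filter.mp h).1
      rw [h2, Finset.card_insert_of_notMem h3] at hN
      rw [h1]
      omega
    obtain ⟨n', hn'D, hn'card, hn'κ⟩ := ih (insert ℓ m) hfilt hκn'
    exact ⟨n', hn'D, hn'card.trans hcard, hn'κ⟩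

end Summit.BirchSwinnertonDyer.Rank1Residual.JET.Section6
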